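/-
Free seat `ym-line-cbag-p1` LEAD (prover-ym-line-cbag-p1-g5-0; own items 22254 `BoxFloorAllGroups` / 22893 `ExpChartPackage2` closed), route
`ColdBoxAllGroups`, helping crux `BulkAllGroups` (stmt-QuantumFields-22255), line `dlr-chessboard-G`, lead p2's PLAN v6 work package «p1:
KernelDatumBoundsG» — part 2: deterministic majorants of the PLAN-v6 quantities and the one-scale WINDOW with datum.
-/
import Summits.QuantumFields.YangMills.Theorems.ColdBoxAllGroupsBulkAllGroupsKernelDatumBoundsGPrelims
import Summits.QuantumFields.YangMills.Theorems.ColdBoxAllGroupsBoxFloorAllGroupsExponentsG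

/-!
# Crux `BulkAllGroups` (stmt-QuantumFields-22255), package «KernelDatumBoundsG», part 2: majorants at fixed `β ≥ 1` and the window

PLAN v6 (crux dir `Cruxes/BulkAllGroups/PLAN-v6.md`) fixes, for `0 < θ ≤ 1/200` (`δ = θ/5`, `A = θ/20`, `ε = 6θ`), `H = ⌈β^θ⌉`, constants
`Ca, CE` (datum package), `C₂` (chart density), `D` (colours): `r = Ca·β^{3θ+θ/5−1/2}`, `B = CE(2H+3)⁴β^{2(θ/5)−1}`,
`L = (12H²+2H+1)(√2·√(β^{2(6θ)−1}) + 8r)`, `m = 2L`, `ℓ = 2C₂m²`, `τ = 190βm³`, `w = 120(2H+1)⁴τ + 4(2H+1)⁴ℓ`, `R = β^{6θ}/(4(√D+1))`,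
`R' = √(βB) + 4√β·r`, `mE = √D(12H²+2H+1)((R+R') + 4√β·r)/√β`, `P = 240D(2H+1)⁴e^{−R²/2}`, `M = β^{2(6θ)}`, `K₁ = 2D(R'²+2)`, `K₂ = 3D²(R'⁴+11)`.
This file records, at every `β ≥ 1`, the monomial majorants of `w`, `τ`, `K₁, K₂, K₁², 2(1+2D²(R'⁴+3))`, `P`, `√P` (from part 1), and derives the
WINDOW (`mE ≤ m`, `(D/2)(R+R')²/β + 190mE³ < β^{2(6θ)−1}`) from three monomial smallness conditions at `β`; part 3 (`…KernelDatumBoundsG`) makes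
everything eventual.  Pure real analysis; no sorry; no definition; standard axioms.  NOT a claim about the mass gap: rung-level support (R2xi-G `XiPow`,
RECORD label); the Yang–Mills mass gap is NOT proved by any of this.
-/

set_option autoImplicit false

noncomputable section

open Filter Topology Finset Real

namespace Summit.QuantumFields.YangMills.Theorems.ColdBoxAllGroups

open Summit.QuantumFields.YangMills.Theorems.WeakCouplingRates

variable {β θ Ca CE C₂ : ℝ}

/-! ## `rpow` spellings -/

/-- `β^{2(6θ)} = β^{12θ}`. -/
theorem rpow_two_mul_six (β θ : ℝ) : β ^ (2 * (6 * θ)) = β ^ (12 * θ) := by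
  congr 1; ring

/-- `(β^{2(6θ)})² = β^{24θ}` (`β ≥ 0`). -/
theorem rpow_two_mul_six_sq (hβ : 0 ≤ β) (θ : ℝ) : (β ^ (2 * (6 * θ))) ^ 2 = β ^ (24 * θ) := by
  rw [← Real.rpow_natCast, ← Real.rpow_mul hβ]; congr 1; push_cast; ring

/-! ## Majorants of the tilt, the cubic remainder, the moment constants and the bad mass at fixed `β ≥ 1` -/

/-- **The tilt size** `w ≤ A₁β^{28θ−1/2} + A₂β^{20θ−1}`, `A₁ = 120·625·190·cm³`, `A₂ = 4·625·2C₂·cm²`, `cm = 106(√2+8Ca)`. -/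
theorem tiltD_majorant (hβ : 1 ≤ β) (hθ : 0 ≤ θ) (hCa : 0 ≤ Ca) (hC₂ : 0 ≤ C₂) :
    (120 * (2 * (⌈β ^ θ⌉₊ : ℝ) + 1) ^ 4 * (190 * β * (2 * ((12 * (⌈β ^ θ⌉₊ : ℝ) ^ 2 + 2 * ⌈β ^ θ⌉₊ + 1) * (Real.sqrt 2 * Real.sqrt (β ^ (2 * (6 * θ) - 1)) + 8 * (Ca * β ^ (3 * θ + θ / 5 - 1 / 2))))) ^ 3) + 4 * (2 * (⌈β ^ θ⌉₊ : ℝ) + 1) ^ 4 * (2 * C₂ * (2 * ((12 * (⌈β ^ θ⌉₊ : ℝ) ^ 2 + 2 * ⌈β ^ θ⌉₊ + 1) * (Real.sqrt 2 * Real.sqrt (β ^ (2 * (6 * θ) - 1)) + 8 * (Ca * β ^ (3 * θ + θ / 5 - 1 / 2))))) ^ 2)) ≤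
      (120 * 625 * 190 * (106 * (Real.sqrt 2 + 8 * Ca)) ^ 3) * β ^ (28 * θ - 1 / 2) + (4 * 625 * (2 * C₂) * (106 * (Real.sqrt 2 + 8 * Ca)) ^ 2) * β ^ (20 * θ - 1) :=
  tiltD_le hβ hθ hC₂ (linkRadiusD_nonneg β θ Ca hCa (by linarith)) (linkRadiusD_le hβ hθ hCa)

/-- **The cubic remainder** `τ = 190βm³ ≤ 190cm³β^{24θ−1/2}`. -/
theorem cubicD_majorant (hβ : 1 ≤ β) (hθ : 0 ≤ θ) (hCa : 0 ≤ Ca) :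
    (190 * β * (2 * ((12 * (⌈β ^ θ⌉₊ : ℝ) ^ 2 + 2 * ⌈β ^ θ⌉₊ + 1) * (Real.sqrt 2 * Real.sqrt (β ^ (2 * (6 * θ) - 1)) + 8 * (Ca * β ^ (3 * θ + θ / 5 - 1 / 2))))) ^ 3) ≤ 190 * (106 * (Real.sqrt 2 + 8 * Ca)) ^ 3 * β ^ (24 * θ - 1 / 2) :=
  (cubicD_le hβ (linkRadiusD_nonneg β θ Ca hCa (by linarith)) (linkRadiusD_le hβ hθ hCa)).1

/-- The scaled background bound is nonnegative. -/
theorem backgroundD_nonneg (hβ : 0 ≤ β) (hCa : 0 ≤ Ca) (θ CE : ℝ) : 0 ≤ (Real.sqrt (β * (CE * (2 * (⌈β ^ θ⌉₊ : ℝ) + 3) ^ 4 * β ^ (2 * (θ / 5) - 1))) + 4 * (Real.sqrt β * (Ca * β ^ (3 * θ + θ / 5 - 1 / 2)))) := by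
  have : 0 ≤ Ca * β ^ (3 * θ + θ / 5 - 1 / 2) := mul_nonneg hCa (Real.rpow_nonneg hβ _)
  positivity

/-- **The moment constants** `K₁ ≤ k₁β^{2c}`, `K₂ ≤ k₂β^{4c}`, `K₁² ≤ k₃β^{4c}`, `2(1+2D²(R'⁴+3)) ≤ k₄β^{4c}` (`c = 3θ+θ/5`, `cR = 49√CE+4Ca`). -/
theorem momentsD_majorant (D : ℕ) (hβ : 1 ≤ β) (hθ : 0 ≤ θ) (hCa : 0 ≤ Ca) :
    (2 * (D : ℝ) * ((Real.sqrt (β * (CE * (2 * (⌈β ^ θ⌉₊ : ℝ) + 3) ^ 4 * β ^ (2 * (θ / 5) - 1))) + 4 * (Real.sqrt β * (Ca * β ^ (3 * θ + θ / 5 - 1 / 2)))) ^ 2 + 2)) ≤ (2 * (D : ℝ) * ((49 * Real.sqrt CE + 4 * Ca) ^ 2 + 2)) * β ^ (2 * (3 * θ + θ / 5)) ∧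
      (3 * (D : ℝ) ^ 2 * ((Real.sqrt (β * (CE * (2 * (⌈β ^ θ⌉₊ : ℝ) + 3) ^ 4 * β ^ (2 * (θ / 5) - 1))) + 4 * (Real.sqrt β * (Ca * β ^ (3 * θ + θ / 5 - 1 / 2)))) ^ 4 + 11)) ≤ (3 * (D : ℝ) ^ 2 * ((49 * Real.sqrt CE + 4 * Ca) ^ 4 + 11)) * β ^ (4 * (3 * θ + θ / 5)) ∧
      (2 * (D : ℝ) * ((Real.sqrt (β * (CE * (2 * (⌈β ^ θ⌉₊ : ℝ) + 3) ^ 4 * β ^ (2 * (θ / 5) - 1))) + 4 * (Real.sqrt β * (Ca * β ^ (3 * θ + θ / 5 - 1 / 2)))) ^ 2 + 2)) ^ 2 ≤ (4 * (D : ℝ) ^ 2 * ((49 * Real.sqrt CE + 4 * Ca) ^ 2 + 2) ^ 2) * β ^ (4 * (3 * θ + θ / 5)) ∧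
      2 * (1 + 2 * (D : ℝ) ^ 2 * ((Real.sqrt (β * (CE * (2 * (⌈β ^ θ⌉₊ : ℝ) + 3) ^ 4 * β ^ (2 * (θ / 5) - 1))) + 4 * (Real.sqrt β * (Ca * β ^ (3 * θ + θ / 5 - 1 / 2)))) ^ 4 + 3)) ≤ (2 * (1 + 2 * (D : ℝ) ^ 2 * ((49 * Real.sqrt CE + 4 * Ca) ^ 4 + 3))) * β ^ (4 * (3 * θ + θ / 5)) :=
  momentsD_le D hβ (by positivity) (backgroundD_nonneg (by linarith) hCa θ CE) (backgroundD_le hβ hθ hCa)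

/-- **The bad mass** `P ≤ 150000·D·β^{4θ}e^{−b₀β^{12θ}}` and `√P ≤ √(150000D)·β^{2θ}e^{−(b₀/2)β^{12θ}}` (`b₀ = 1/(32(√D+1)²)`). -/
theorem badMassD_majorant (D : ℕ) (hβ : 1 ≤ β) (hθ : 0 ≤ θ) :
    (240 * (D : ℝ) * (2 * (⌈β ^ θ⌉₊ : ℝ) + 1) ^ 4 * Real.exp (-(β ^ (6 * θ) / (4 * (Real.sqrt D + 1))) ^ 2 / 2)) ≤ 150000 * (D : ℝ) * β ^ (4 * θ) * Real.exp (-((1 / (32 * (Real.sqrt D + 1) ^ 2)) * β ^ (12 * θ))) ∧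
      Real.sqrt (240 * (D : ℝ) * (2 * (⌈β ^ θ⌉₊ : ℝ) + 1) ^ 4 * Real.exp (-(β ^ (6 * θ) / (4 * (Real.sqrt D + 1))) ^ 2 / 2)) ≤ Real.sqrt (150000 * (D : ℝ)) * β ^ (2 * θ) * Real.exp (-((1 / (64 * (Real.sqrt D + 1) ^ 2)) * β ^ (12 * θ))) := by
  rw [exp_neg_sq_div_two_eq]
  exact ⟨badMassD_le D hβ hθ, sqrt_badMassD_le D hβ hθ⟩

/-! ## The window -/

/-- **The Gaussian chart bound is inside the link window** once `√D(cR+4Ca)β^{3θ+θ/5−1/2} ≤ β^{6θ−1/2}/4`: then `mE ≤ m`, `0 ≤ mE ≤ (53/2)β^{8θ−1/2}`. -/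
theorem mED_majorant (D : ℕ) (hβ : 1 ≤ β) (hθ : 0 ≤ θ) (hCa : 0 ≤ Ca)
    (haux : Real.sqrt D * ((49 * Real.sqrt CE + 4 * Ca) + 4 * Ca) * β ^ (3 * θ + θ / 5 - 1 / 2) ≤ β ^ (6 * θ - 1 / 2) / 4) :
    (Real.sqrt D * ((12 * (⌈β ^ θ⌉₊ : ℝ) ^ 2 + 2 * ⌈β ^ θ⌉₊ + 1) * (((β ^ (6 * θ) / (4 * (Real.sqrt D + 1))) + (Real.sqrt (β * (CE * (2 * (⌈β ^ θ⌉₊ : ℝ) + 3) ^ 4 * β ^ (2 * (θ / 5) - 1))) + 4 * (Real.sqrt β * (Ca * β ^ (3 * θ + θ / 5 - 1 / 2))))) + 4 * (Real.sqrt β * (Ca * β ^ (3 * θ + θ / 5 - 1 / 2))))) / Real.sqrt β) ≤ (2 * ((12 * (⌈β ^ θ⌉₊ : ℝ) ^ 2 + 2 * ⌈β ^ θ⌉₊ + 1) * (Real.sqrt 2 * Real.sqrt (β ^ (2 * (6 * θ) - 1)) + 8 * (Ca * β ^ (3 * θ + θ / 5 - 1 / 2))))) ∧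
      (Real.sqrt D * ((12 * (⌈β ^ θ⌉₊ : ℝ) ^ 2 + 2 * ⌈β ^ θ⌉₊ + 1) * (((β ^ (6 * θ) / (4 * (Real.sqrt D + 1))) + (Real.sqrt (β * (CE * (2 * (⌈β ^ θ⌉₊ : ℝ) + 3) ^ 4 * β ^ (2 * (θ / 5) - 1))) + 4 * (Real.sqrt β * (Ca * β ^ (3 * θ + θ / 5 - 1 / 2))))) + 4 * (Real.sqrt β * (Ca * β ^ (3 * θ + θ / 5 - 1 / 2))))) / Real.sqrt β) ≤ 53 / 2 * β ^ (8 * θ - 1 / 2) ∧ 0 ≤ (Real.sqrt D * ((12 * (⌈β ^ θ⌉₊ : ℝ) ^ 2 + 2 * ⌈β ^ θ⌉₊ + 1) * (((β ^ (6 * θ) / (4 * (Real.sqrt D + 1))) + (Real.sqrt (β * (CE * (2 * (⌈β ^ θ⌉₊ : ℝ) + 3) ^ 4 * β ^ (2 * (θ / 5) - 1))) + 4 * (Real.sqrt β * (Ca * β ^ (3 * θ + θ / 5 - 1 / 2))))) + 4 * (Real.sqrt β * (Ca * β ^ (3 * θ + θ / 5 - 1 / 2))))) / Real.sqrt β) :=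 by
  have hβ0 : 0 < β := by linarith
  have hr0 : 0 ≤ Ca * β ^ (3 * θ + θ / 5 - 1 / 2) := mul_nonneg hCa (Real.rpow_nonneg hβ0.le _)
  have hR'0 := backgroundD_nonneg hβ0.le hCa θ CE
  have h1 := mED_le D hβ hθ hCa (backgroundD_le (CE := CE) hβ hθ hCa)
  obtain ⟨-, -, -, -, hP⟩ := box_counts hβ hθ
  set PH : ℝ := 12 * (⌈β ^ θ⌉₊ : ℝ) ^ 2 + 2 * ⌈β ^ θ⌉₊ + 1 with hPH
  have hPH0 : 0 ≤ PH := by positivity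
  have hpos : 0 ≤ β ^ (6 * θ - 1 / 2) := Real.rpow_nonneg hβ0.le _
  have h2 : (Real.sqrt D * ((12 * (⌈β ^ θ⌉₊ : ℝ) ^ 2 + 2 * ⌈β ^ θ⌉₊ + 1) * (((β ^ (6 * θ) / (4 * (Real.sqrt D + 1))) + (Real.sqrt (β * (CE * (2 * (⌈β ^ θ⌉₊ : ℝ) + 3) ^ 4 * β ^ (2 * (θ / 5) - 1))) + 4 * (Real.sqrt β * (Ca * β ^ (3 * θ + θ / 5 - 1 / 2))))) + 4 * (Real.sqrt β * (Ca * β ^ (3 * θ + θ / 5 - 1 / 2))))) / Real.sqrt β) ≤ PH * (β ^ (6 * θ - 1 / 2) / 2) := by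
    refine h1.trans (mul_le_mul_of_nonneg_left ?_ hPH0)
    linarith
  refine ⟨h2.trans ?_, h2.trans ?_, by positivity⟩
  · -- `PH·β^{6θ−1/2}/2 ≤ m = 2PH(√2 β^{6θ−1/2} + 8r)`
    rw [sqrt_rpow_twelve hβ0.le]
    have hs2 : (1 : ℝ) ≤ Real.sqrt 2 := Real.one_le_sqrt.2 (by norm_num)
    have : β ^ (6 * θ - 1 / 2) / 2 ≤ 2 * (Real.sqrt 2 * β ^ (6 * θ - 1 / 2) + 8 * (Ca * β ^ (3 * θ + θ / 5 - 1 / 2))) := by nlinarith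
    calc PH * (β ^ (6 * θ - 1 / 2) / 2) ≤ PH * (2 * (Real.sqrt 2 * β ^ (6 * θ - 1 / 2) + 8 * (Ca * β ^ (3 * θ + θ / 5 - 1 / 2)))) :=
          mul_le_mul_of_nonneg_left this hPH0
      _ = _ := by ring
  · have hy2 : (β ^ θ) ^ 2 = β ^ (2 * θ) := by rw [rpow_theta_pow hβ0.le 2]; norm_num
    have hsplit : β ^ (2 * θ) * β ^ (6 * θ - 1 / 2) = β ^ (8 * θ - 1 / 2) := by rw [← Real.rpow_add hβ0]; ring_nf
    calc PH * (β ^ (6 * θ - 1 / 2) / 2) ≤ 53 * (β ^ θ) ^ 2 * (β ^ (6 * θ - 1 / 2) / 2) := by gcongr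
      _ = 53 / 2 * (β ^ (2 * θ) * β ^ (6 * θ - 1 / 2)) := by rw [hy2]; ring
      _ = 53 / 2 * β ^ (8 * θ - 1 / 2) := by rw [hsplit]

/-- **The one-scale window with datum** from three monomial smallness conditions at `β ≥ 1`. -/
theorem windowD_of (D : ℕ) (hβ : 1 ≤ β) (hθ : 0 ≤ θ) (hCa : 0 ≤ Ca)
    (haux1 : Real.sqrt D * ((49 * Real.sqrt CE + 4 * Ca) + 4 * Ca) * β ^ (3 * θ + θ / 5 - 1 / 2) ≤ β ^ (6 * θ - 1 / 2) / 4)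
    (haux2 : (49 * Real.sqrt CE + 4 * Ca) * β ^ (3 * θ + θ / 5) ≤ β ^ (6 * θ) / (4 * (Real.sqrt D + 1)))
    (haux3 : 190 * (53 / 2) ^ 3 * β ^ (24 * θ - 3 / 2) ≤ β ^ (12 * θ - 1) / 2) :
    (D : ℝ) / 2 * ((β ^ (6 * θ) / (4 * (Real.sqrt D + 1))) + (Real.sqrt (β * (CE * (2 * (⌈β ^ θ⌉₊ : ℝ) + 3) ^ 4 * β ^ (2 * (θ / 5) - 1))) + 4 * (Real.sqrt β * (Ca * β ^ (3 * θ + θ / 5 - 1 / 2))))) ^ 2 / β + 190 * (Real.sqrt D * ((12 * (⌈β ^ θ⌉₊ : ℝ) ^ 2 + 2 * ⌈β ^ θ⌉₊ + 1) * (((β ^ (6 * θ) / (4 * (Real.sqrt D + 1))) + (Real.sqrt (β * (CE * (2 * (⌈β ^ θ⌉₊ : ℝ) + 3) ^ 4 * β ^ (2 * (θ / 5) - 1))) + 4 * (Real.sqrt β * (Ca * β ^ (3 * θ + θ / 5 - 1 / 2))))) + 4 * (Real.sqrt β * (Ca * β ^ (3 * θ + θ / 5 - 1 / 2))))) / Real.sqrt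 β) ^ 3 < β ^ (2 * (6 * θ) - 1) := by
  have hβ0 : 0 < β := by linarith
  obtain ⟨-, hmE, hmE0⟩ := mED_majorant (CE := CE) D hβ hθ hCa haux1
  have hR'0 := backgroundD_nonneg hβ0.le hCa θ CE
  have hR' : (Real.sqrt (β * (CE * (2 * (⌈β ^ θ⌉₊ : ℝ) + 3) ^ 4 * β ^ (2 * (θ / 5) - 1))) + 4 * (Real.sqrt β * (Ca * β ^ (3 * θ + θ / 5 - 1 / 2)))) ≤ (β ^ (6 * θ) / (4 * (Real.sqrt D + 1))) := (backgroundD_le hβ hθ hCa).trans haux2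
  have hR0 : 0 ≤ (β ^ (6 * θ) / (4 * (Real.sqrt D + 1))) := by positivity
  have hD1 : (0 : ℝ) < Real.sqrt D + 1 := by positivity
  have hDle : (D : ℝ) ≤ (Real.sqrt D + 1) ^ 2 := by
    have h := Real.sq_sqrt (Nat.cast_nonneg D : (0 : ℝ) ≤ D)
    nlinarith [Real.sqrt_nonneg (D : ℝ)]
  -- first term: `(D/2)(R+R')²/β ≤ 2D R²/β ≤ β^{12θ−1}/8`
  have hsum : ((β ^ (6 * θ) / (4 * (Real.sqrt D + 1))) + (Real.sqrt (β * (CE * (2 * (⌈β ^ θ⌉₊ : ℝ) + 3) ^ 4 * β ^ (2 * (θ / 5) - 1))) + 4 * (Real.sqrt β * (Ca * β ^ (3 * θ + θ / 5 - 1 / 2))))) ^ 2 ≤ (2 * (β ^ (6 * θ) / (4 * (Real.sqrt D + 1)))) ^ 2 := pow_le_pow_left₀ (by positivity) (by linarith) 2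
  have hRsq : (2 * (β ^ (6 * θ) / (4 * (Real.sqrt D + 1)))) ^ 2 = β ^ (12 * θ) / (4 * (Real.sqrt D + 1) ^ 2) := by
    rw [mul_pow, div_pow, ← Real.rpow_natCast (β ^ (6 * θ)) 2, ← Real.rpow_mul hβ0.le,
      show 6 * θ * ((2 : ℕ) : ℝ) = 12 * θ by push_cast; ring]
    field_simp
    ring
  have h12 : β ^ (12 * θ) / β = β ^ (12 * θ - 1) := by rw [Real.rpow_sub_one hβ0.ne']
  have hfirst : (D : ℝ) / 2 * ((β ^ (6 * θ) / (4 * (Real.sqrt D + 1))) + (Real.sqrt (β * (CE * (2 * (⌈β ^ θ⌉₊ : ℝ) + 3) ^ 4 * β ^ (2 * (θ / 5) - 1))) + 4 * (Real.sqrt β * (Ca * β ^ (3 * θ + θ / 5 - 1 / 2))))) ^ 2 / β ≤ β ^ (12 * θ - 1) / 8 := by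
    have hD0 : (0 : ℝ) ≤ (D : ℝ) / 2 := by positivity
    calc (D : ℝ) / 2 * ((β ^ (6 * θ) / (4 * (Real.sqrt D + 1))) + (Real.sqrt (β * (CE * (2 * (⌈β ^ θ⌉₊ : ℝ) + 3) ^ 4 * β ^ (2 * (θ / 5) - 1))) + 4 * (Real.sqrt β * (Ca * β ^ (3 * θ + θ / 5 - 1 / 2))))) ^ 2 / β ≤ (D : ℝ) / 2 * (2 * (β ^ (6 * θ) / (4 * (Real.sqrt D + 1)))) ^ 2 / β := by gcongr
      _ = (D : ℝ) / (8 * (Real.sqrt D + 1) ^ 2) * (β ^ (12 * θ) / β) := by rw [hRsq]; field_simp; ring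
      _ ≤ 1 / 8 * (β ^ (12 * θ) / β) := by
          refine mul_le_mul_of_nonneg_right ?_ (by positivity)
          rw [div_le_iff₀ (by positivity)]; linarith
      _ = β ^ (12 * θ - 1) / 8 := by rw [h12]; ring
  -- second term: `190 mE³ ≤ 190 (53/2)³ β^{24θ−3/2} ≤ β^{12θ−1}/2`
  have hcube : (Real.sqrt D * ((12 * (⌈β ^ θ⌉₊ : ℝ) ^ 2 + 2 * ⌈β ^ θ⌉₊ + 1) * (((β ^ (6 * θ) / (4 * (Real.sqrt D + 1))) + (Real.sqrt (β * (CE * (2 * (⌈β ^ θ⌉₊ : ℝ) + 3) ^ 4 * β ^ (2 * (θ / 5) - 1))) + 4 * (Real.sqrt β * (Ca * β ^ (3 * θ + θ / 5 - 1 / 2))))) + 4 * (Real.sqrt β * (Ca * β ^ (3 * θ + θ / 5 - 1 / 2))))) / Real.sqrt β) ^ 3 ≤ (53 / 2 * β ^ (8 * θ - 1 / 2)) ^ 3 := pow_le_pow_left₀ hmE0 hmE 3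
  have hcube' : (53 / 2 * β ^ (8 * θ - 1 / 2)) ^ 3 = (53 / 2) ^ 3 * β ^ (24 * θ - 3 / 2) := by
    rw [mul_pow, ← Real.rpow_natCast (β ^ (8 * θ - 1 / 2)) 3, ← Real.rpow_mul hβ0.le]; congr 2; push_cast; ring
  have hsecond : 190 * (Real.sqrt D * ((12 * (⌈β ^ θ⌉₊ : ℝ) ^ 2 + 2 * ⌈β ^ θ⌉₊ + 1) * (((β ^ (6 * θ) / (4 * (Real.sqrt D + 1))) + (Real.sqrt (β * (CE * (2 * (⌈β ^ θ⌉₊ : ℝ) + 3) ^ 4 * β ^ (2 * (θ / 5) - 1))) + 4 * (Real.sqrt β * (Ca * β ^ (3 * θ + θ / 5 - 1 / 2))))) + 4 * (Real.sqrt β * (Ca * β ^ (3 * θ + θ / 5 - 1 / 2))))) / Real.sqrt β) ^ 3 ≤ β ^ (12 * θ - 1) / 2 := by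
    calc 190 * (Real.sqrt D * ((12 * (⌈β ^ θ⌉₊ : ℝ) ^ 2 + 2 * ⌈β ^ θ⌉₊ + 1) * (((β ^ (6 * θ) / (4 * (Real.sqrt D + 1))) + (Real.sqrt (β * (CE * (2 * (⌈β ^ θ⌉₊ : ℝ) + 3) ^ 4 * β ^ (2 * (θ / 5) - 1))) + 4 * (Real.sqrt β * (Ca * β ^ (3 * θ + θ / 5 - 1 / 2))))) + 4 * (Real.sqrt β * (Ca * β ^ (3 * θ + θ / 5 - 1 / 2))))) / Real.sqrt β) ^ 3 ≤ 190 * ((53 / 2) ^ 3 * β ^ (24 * θ - 3 / 2)) := by rw [← hcube']; gcongr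
      _ = 190 * (53 / 2) ^ 3 * β ^ (24 * θ - 3 / 2) := by ring
      _ ≤ β ^ (12 * θ - 1) / 2 := haux3
  have hpos : 0 < β ^ (12 * θ - 1) := Real.rpow_pos_of_pos hβ0 _
  rw [show (2 : ℝ) * (6 * θ) - 1 = 12 * θ - 1 by ring]
  linarith

end Summit.QuantumFields.YangMills.Theorems.ColdBoxAllGroups

end
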